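import Mathlib
import Literature.NumberTheory.ComplexMultiplication.ComplexReflexField
import Literature.NumberTheory.ComplexMultiplication.CMTypeBasic
import HarnessLib

/-!
# The reflex of the conjugate CM type: same reflex field, opposite reflex type
# ([Liu2021] Remark 4.4; Shimura 1998 §8.3 Prop. 28)

AS PRINTED.  Y. Liu, *Fourier–Jacobi cycles and arithmetic relative trace formula*, Camb. J. Math. 9 (2021)
= arXiv:2102.11518 [Liu2021], §4.1 (author's TeX `FJcycle.tex`, md5 `6db49a74122d…`, held extraction
`paper:arxiv-2102.11518` chunk p0018):
* Definition 4.3 (2) (TeX l. 1921; p0018 L41): "we call `Φ_μ` the *CM type* of `μ`. Furthermore, we denote by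
  `M'_μ ⊆ ℂ` the reflex field of `(E, Φ_μ)`, with the induced CM type `Ψ_μ`."
* **Remark 4.4** (TeX ll. 1930–1933; p0018 L50–51): "It is clear that `μ^c` is conjugate symplectic of the same
  weight as `μ`. Moreover, we have `M_{μ^c} = M_μ`, `M'_{μ^c} = M'_μ`, and that `Ψ_{μ^c}` is the opposite CM type
  of `Ψ_μ`."

Here `μ^c = μ ∘ c` and the CM type of `μ^c` is the conjugate type `\bar Φ_μ = {\bar τ' : τ' ∈ Φ_μ}` — in the
tree `CMTypeOps.bar` (`CMTypeBasic`), and `Φ_{μ^c} = \bar Φ_μ` is the theorem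
`IsConjugateSymplectic.cmType_galConj` of `NumberTheory/Automorphic/IdeleClassCharacterConjugate`, which lists
the two REFLEX-SIDE clauses of Remark 4.4 under "NOT HERE".  This file proves them, as statements about an
arbitrary complex CM type `Φ : CMType K` (the tree's carrier `Literature.AlgebraicGeometry.Motives.CMType`) and
its conjugate `\bar Φ`, in the vocabulary of `ReflexType` / `ReflexPair` / `ReflexCMType` / `ComplexReflexField`
(Shimura, *Abelian Varieties with Complex Multiplication and Modular Functions* (1998), §8.3 Prop. 28
[Shimura1998]: the reflex field `K*` is the fixed field of `H* = {γ | γΦ = Φ}`, the reflex type `{ψⱼ}` is cut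
out by `S* = {σ⁻¹ | σ ∈ S}`, and `K* = ℚ(∑ᵢ ξ^{φᵢ}) ⊆ ℂ`):

* § 1 (group level) `\bar Φ` is the COMPLEMENT of `Φ` (the carrier of `CMTypeOps.bar Φ` is `Φᶜ`; read in a
  Galois CM field it is also the translate `ρ • Φ_L`, relation (1) of Shimura's Prop. 25,
  `CMCondition.compl_typeLift_eq_smul`), and complements have the same stabiliser (Mathlib `stabilizer_compl`);
  `typeLift_compl`, `reflexLift_compl` (`S(Φᶜ) = S(Φ)ᶜ`, `S*(Φᶜ) = S*(Φ)ᶜ`);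
* § 2 (Galois side, any `Ω/F`) **`reflexField F Ω Φᶜ = reflexField F Ω Φ`** (`reflexField_compl`), and the reflex
  type of `Φᶜ` is the complement of that of `Φ` once the two (equal) reflex fields are identified
  (`smul_val_mem_reflexType_compl_iff`, `mem_reflexType_compl_iff`, transport along `IntermediateField.equivOfEq`);
* § 3 (complex CM types) `algValuedIn ι (bar Φ) = (algValuedIn ι Φ)ᶜ`, hence
  **`reflexField ℚ L (\bar Φ_L) = reflexField ℚ L (Φ_L)`** (`reflexField_algValuedIn_bar`: "`M'_{μ^c} = M'_μ`"
  read in any field `L` receiving `K`), and INSIDE `ℂ`, with no auxiliary field at all,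
  **`traceField (bar Φ) = traceField Φ`** (`traceField_bar`) — Liu's `M'_μ ⊆ ℂ` is the tree's
  `traceField Φ_μ = ℚ(tr_Φ(x) | x)` (`ComplexReflexField`, Shimura's `K* = ℚ(∑ᵢ ξ^{φᵢ})`), and
  `tr_Φ(x) + tr_{\bar Φ}(x) = Tr_{K/ℚ}(x) ∈ ℚ` (`cmTypeTrace_add_cmTypeTrace_bar`, Mathlib
  `trace_eq_sum_embeddings`), so each trace field contains the other's generators;
* § 4 (the reflex TYPE) for a CM field `L` normal over `ℚ` receiving `K` via `φ`, read in `ℂ` via `ι`: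
  **`reflexCMType ι (bar Φ) φ` is the conjugate ("opposite") CM type `bar (reflexCMType ι Φ φ)`**, transported
  along the identification of the two equal reflex fields (`reflexCMType_bar`; membership forms
  `comp_smul_val_mem_reflexCMType_bar_iff`, `…_iff_conjugate_mem`, `mem_reflexCMType_bar_iff`) — "`Ψ_{μ^c}` is
  the opposite CM type of `Ψ_μ`"; and `reflexLift (\bar Φ_L) φ = ρ • reflexLift Φ_L φ` (`reflexLift_algValuedIn_bar_eq_smul`).

The character-level sentences of Remark 4.4 (for a conjugate symplectic `μ` and `μ^c`) follow by rewriting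
with `IsConjugateSymplectic.cmType_galConj`; they are stated in the companion
`NumberTheory/Automorphic/IdeleClassCharacterConjugateReflex` so that this file stays inside
`ComplexMultiplication/` (no adelic imports).

Everything here is proved; no definitions, no named facts (D-0026).  NOT here: `M_μ ⊇ M'_μ` and `M_{μ^c} = M_μ`
(the field generated by the values of `μ^{alg}`: `NumberTheory/Automorphic/IdeleClassCharacterAlgebraicTwist`,
`muAlgValueField_galConj`); "independent of `L`" for the reflex TYPE (see `ComplexReflexField`, NOT HERE there).

Mathlib searched (pin): `stabilizer_compl` (stabiliser of a complement), `IntermediateField.equivOfEq` (+ `_apply`),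
`Finset.sum_add_sum_compl`, `trace_eq_sum_embeddings`, `RingHom.equivRatAlgHom`,
`IntermediateField.adjoin_le_iff`, `algebraMap_mem` (used); Mathlib has no CM types / reflex fields.

## References

* [Liu2021] Y. Liu, *Fourier–Jacobi cycles and arithmetic relative trace formula* (appendix by C. Li and
  Y. Zhu), Camb. J. Math. 9 (2021), no. 1, 1–147, arXiv:2102.11518 — §4.1 Definition 4.3 (2), Remark 4.4.
* [Shimura1998] G. Shimura, *Abelian Varieties with Complex Multiplication and Modular Functions*, Princeton
  (1998) — §8.1 Prop. 25 (relation (1)), §8.3 Prop. 28 (reflex field and reflex type).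
* [MilneCM2006] J. S. Milne, *Complex Multiplication* (course notes, 2006), Ch. I §1 (`\bar Φ = ιΦ`, the
  conjugate CM type).

## Provenance

pub-hodgecm2 (COR-CM) literature seat `lit-liu-1` gen 4, «Liu 2021 inputs»: CITE→PROVE flip of the reflex
half of [Liu2021] Remark 4.4 (row L4 of the cell's `lit/LIU2021.md`).
-/

set_option autoImplicit false

open scoped Pointwise

namespace Literature.NumberTheory.ComplexMultiplication

open Literature.AlgebraicGeometry.Motives (CMType)
open NumberField
open CMTypeOps (bar mem_bar_iff conjugate_mem_iff_notMem)

/-! ## § 1. Complements at the level of the group -/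

section Abstract

variable {G E : Type*} [Group G] [MulAction G E]

/-- `S(Φᶜ, φh) = S(Φ, φh)ᶜ` ("`G = S ∪ Sρ`", relation (1): the elements inducing an embedding OUTSIDE `Φ`).
[cite: Shimura1998, §8.1 Prop. 25] -/
theorem typeLift_compl (Φ : Set E) (φh : E) : (typeLift Φᶜ φh : Set G) = (typeLift Φ φh)ᶜ :=
  Set.ext fun _ => Iff.rfl

/-- `S*(Φᶜ, φh) = S*(Φ, φh)ᶜ` ("`G = S* ∪ S*ρ`"). [cite: Shimura1998, §8.3 Prop. 28] -/
theorem reflexLift_compl (Φ : Set E) (φh : E) : (reflexLift Φᶜ φh : Set G) = (reflexLift Φ φh)ᶜ :=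
  Set.ext fun _ => Iff.rfl

end Abstract

/-! ## § 2. The reflex field and reflex type of the complementary type (Galois side) -/

section Field

variable (F Ω : Type*) [Field F] [Field Ω] [Algebra F Ω]

/-- **The complementary type has the same reflex field**: `K*(Φᶜ) = K*(Φ)` (both are the fixed field of
`H* = Stab(Φ) = Stab(Φᶜ)`, Mathlib `stabilizer_compl`). [cite: Shimura1998, §8.3 Prop. 28] -/
theorem reflexField_compl {E' : Type*} [MulAction (Ω ≃ₐ[F] Ω) E'] (Φ : Set E') :
    reflexField F Ω Φᶜ = reflexField F Ω Φ := by
  rw [reflexField_eq_fixedField, reflexField_eq_fixedField, stabilizer_compl (Ω ≃ₐ[F] Ω)]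

variable {K : Type*} [Field K] [Algebra F K]

/-- Restricting `g • ι_T` along the identification `S = T` of two equal intermediate fields gives `g • ι_S`
(as `F`-algebra maps). [cite: Shimura1998, §8.3 Prop. 28] -/
theorem smul_val_comp_equivOfEq {S T : IntermediateField F Ω} (h : S = T) (g : Ω ≃ₐ[F] Ω) :
    (g • T.val).comp (IntermediateField.equivOfEq h : S ≃ₐ[F] T).toAlgHom = g • S.val :=
  AlgHom.ext fun _ => rfl

/-- The same for the underlying ring homomorphisms. [cite: Shimura1998, §8.3 Prop. 28] -/
theorem coe_smul_val_comp_coe_equivOfEq {S T : IntermediateField F Ω} (h : S = T) (g : Ω ≃ₐ[F] Ω) :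
    ((g • T.val : T →ₐ[F] Ω) : T →+* Ω).comp
        ((IntermediateField.equivOfEq h : S ≃ₐ[F] T) : S →+* T) = ((g • S.val : S →ₐ[F] Ω) : S →+* Ω) :=
  RingHom.ext fun _ => rfl

variable [FiniteDimensional F Ω]

/-- **The reflex type of `Φᶜ` is the complement of the reflex type of `Φ`** (on restrictions of `g ∈ G`):
`g|_{K*} ∈ (Φᶜ)* ↔ g ∈ S*(Φᶜ) = S*(Φ)ᶜ ↔ g|_{K*} ∉ Φ*`. [cite: Shimura1998, §8.3 Prop. 28] -/
theorem smul_val_mem_reflexType_compl_iff (Φ : Set (K →ₐ[F] Ω)) (φ : K →ₐ[F] Ω) (g : Ω ≃ₐ[F] Ω) :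
    g • (reflexField F Ω Φᶜ).val ∈ reflexType F Ω Φᶜ φ ↔
      g • (reflexField F Ω Φ).val ∉ reflexType F Ω Φ φ := by
  rw [smul_val_mem_reflexType_iff, smul_val_mem_reflexType_iff, reflexLift_compl, Set.mem_compl_iff]

/-- The same for an arbitrary `F`-embedding `ψ : K*(Φᶜ) → Ω` (`Ω/F` finite normal, so that `ψ = g|_{K*}`),
transported to `K*(Φ)` along `K*(Φ) = K*(Φᶜ)`: `ψ ∈ (Φᶜ)* ↔ ψ|_{K*(Φ)} ∉ Φ*`.
[cite: Shimura1998, §8.3 Prop. 28] -/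
theorem mem_reflexType_compl_iff [Normal F Ω] (Φ : Set (K →ₐ[F] Ω)) (φ : K →ₐ[F] Ω)
    (ψ : reflexField F Ω Φᶜ →ₐ[F] Ω) :
    ψ ∈ reflexType F Ω Φᶜ φ ↔
      ψ.comp (IntermediateField.equivOfEq (reflexField_compl F Ω Φ).symm :
          reflexField F Ω Φ ≃ₐ[F] reflexField F Ω Φᶜ).toAlgHom ∉ reflexType F Ω Φ φ := by
  obtain ⟨g, rfl⟩ := exists_algEquiv_smul_eq (reflexField F Ω Φᶜ).val ψ
  rw [smul_val_mem_reflexType_compl_iff, smul_val_comp_equivOfEq]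

end Field

/-! ## § 3. Complex CM types: the conjugate type `\bar Φ` -/

section Complex

variable {L : Type*} [Field L] [CharZero L] {K : Type*} [Field K] [Algebra ℚ K]

/-- `\bar Φ` read in `Hom_ℚ(K, L)` is the complement of `Φ` read in `Hom_ℚ(K, L)`:
`(\bar Φ)_L = (Φ_L)ᶜ`. [cite: MilneCM2006, Ch. I §1] -/
theorem algValuedIn_bar (ι : L →+* ℂ) (Φ : CMType K) : algValuedIn ι (bar Φ).1 = (algValuedIn ι Φ.1)ᶜ :=
  Set.ext fun _ => Iff.rfl

/-- **`M'_{μ^c} = M'_μ`, read in `L`**: the reflex field of `(K, \bar Φ)` inside any field `L` of characteristic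
zero receiving `K` equals that of `(K, Φ)` — for [Liu2021] take `Φ = Φ_μ`, `\bar Φ = Φ_{μ^c}`
(`IsConjugateSymplectic.cmType_galConj`). [cite: Liu2021, Remark 4.4 (TeX ll. 1930–1933)] -/
theorem reflexField_algValuedIn_bar (ι : L →+* ℂ) (Φ : CMType K) :
    reflexField ℚ L (algValuedIn ι (bar Φ).1) = reflexField ℚ L (algValuedIn ι Φ.1) := by
  rw [algValuedIn_bar, reflexField_compl]

end Complex

/-! ### Inside `ℂ`: the trace field of `\bar Φ` -/

section Trace

variable {K : Type*} [Field K] [NumberField K]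

/-- **`tr_Φ(x) + tr_{\bar Φ}(x) = Tr_{K/ℚ}(x)`**: `Φ ⊔ \bar Φ` is the set of ALL complex embeddings of `K`, over
which the sum of `φ(x)` is the trace (Mathlib `trace_eq_sum_embeddings`).
[cite: Shimura1998, §8.3 Prop. 28] -/
theorem cmTypeTrace_add_cmTypeTrace_bar (Φ : CMType K) (x : K) :
    cmTypeTrace Φ x + cmTypeTrace (bar Φ) x = algebraMap ℚ ℂ (Algebra.trace ℚ K x) := by
  classical
  rw [cmTypeTrace_apply, cmTypeTrace_apply]
  have h : (Set.toFinite (bar Φ).1).toFinset = ((Set.toFinite Φ.1).toFinset)ᶜ := by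
    ext φ
    simp only [Set.Finite.mem_toFinset, Finset.mem_compl, mem_bar_iff]
  rw [h, Finset.sum_add_sum_compl, trace_eq_sum_embeddings ℂ]
  exact Fintype.sum_equiv RingHom.equivRatAlgHom (fun φ : K →+* ℂ => φ x)
    (fun σ : K →ₐ[ℚ] ℂ => σ x) fun _ => rfl

/-- Hence `tr_{\bar Φ}(x) = Tr_{K/ℚ}(x) − tr_Φ(x)`. [cite: Shimura1998, §8.3 Prop. 28] -/
theorem cmTypeTrace_bar (Φ : CMType K) (x : K) :
    cmTypeTrace (bar Φ) x = algebraMap ℚ ℂ (Algebra.trace ℚ K x) - cmTypeTrace Φ x := by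
  rw [← cmTypeTrace_add_cmTypeTrace_bar Φ x, add_sub_cancel_left]

/-- The type traces of `\bar Φ` lie in the trace field `ℚ(tr_Φ(K))` of `Φ`. [cite: Shimura1998, §8.3 Prop. 28] -/
theorem cmTypeTrace_bar_mem_traceField (Φ : CMType K) (x : K) : cmTypeTrace (bar Φ) x ∈ traceField Φ := by
  rw [cmTypeTrace_bar]
  exact sub_mem (algebraMap_mem (traceField Φ) _) (cmTypeTrace_mem_traceField Φ x)

/-- `ℚ(tr_{\bar Φ}(K)) ≤ ℚ(tr_Φ(K))`. [cite: Shimura1998, §8.3 Prop. 28] -/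
theorem traceField_bar_le (Φ : CMType K) : traceField (bar Φ) ≤ traceField Φ :=
  IntermediateField.adjoin_le_iff.mpr (by
    rintro _ ⟨x, rfl⟩
    exact cmTypeTrace_bar_mem_traceField Φ x)

/-- **`M'_{μ^c} = M'_μ` inside `ℂ`** ([Liu2021] Def. 4.3 (2): "`M'_μ ⊆ ℂ` the reflex field of `(E, Φ_μ)`";
Remark 4.4): the complex reflex field `ℚ(tr_Φ(x) | x ∈ K) ⊆ ℂ` (`traceField`, Shimura's `K* = ℚ(∑ᵢ ξ^{φᵢ})`)
of the conjugate type `\bar Φ` is that of `Φ` — for every number field `K` and every `Φ : CMType K`, with no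
auxiliary Galois field. [cite: Liu2021, Remark 4.4 (TeX ll. 1930–1933)] -/
theorem traceField_bar (Φ : CMType K) : traceField (bar Φ) = traceField Φ :=
  le_antisymm (traceField_bar_le Φ)
    (by simpa only [(Subtype.ext (compl_compl Φ.1) : bar (bar Φ) = Φ)] using traceField_bar_le (bar Φ))

end Trace

/-! ## § 4. The reflex CM type of `\bar Φ` is the opposite of the reflex CM type of `Φ` -/

section ReflexType

variable {L : Type*} [Field L] [NumberField L] [IsCMField L] {K : Type*} [Field K] [Algebra ℚ K]

/-- `S*(\bar Φ_L) = ρ • S*(Φ_L)` for a CM field `L` (`ρ = conjGal`): the lifted reflex type of the conjugate type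
is the conjugate translate of the lifted reflex type (complement = `ρ`-translate by the CM condition,
`CMCondition.compl_reflexLift_eq_smul`). [cite: Shimura1998, §8.3 Prop. 28] -/
theorem reflexLift_algValuedIn_bar_eq_smul (ι : L →+* ℂ) (Φ : CMType K) (φ : K →ₐ[ℚ] L) :
    (reflexLift (algValuedIn ι (bar Φ).1) φ : Set (L ≃ₐ[ℚ] L)) =
      (conjGal : L ≃ₐ[ℚ] L) • (reflexLift (algValuedIn ι Φ.1) φ : Set (L ≃ₐ[ℚ] L)) := by
  rw [algValuedIn_bar, reflexLift_compl]
  exact compl_reflexLift_eq_smul (mem_algValuedIn_iff_conjGal_smul_notMem ι Φ) conjGal_central φ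

variable [Normal ℚ L]

/-- For `g ∈ Gal(L/ℚ)`: `ι ∘ g|_{K*(\bar Φ)}` belongs to the reflex CM type of `\bar Φ` iff `ι ∘ g|_{K*(Φ)}` does
NOT belong to the reflex CM type of `Φ` (`S*(\bar Φ_L) = S*(Φ_L)ᶜ`). [cite: Liu2021, Remark 4.4 (TeX ll. 1930–1933)] -/
theorem comp_smul_val_mem_reflexCMType_bar_iff (ι : L →+* ℂ) (Φ : CMType K) (φ : K →ₐ[ℚ] L)
    (g : L ≃ₐ[ℚ] L) :
    ι.comp ((g • (reflexField ℚ L (algValuedIn ι (bar Φ).1)).val :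
        reflexField ℚ L (algValuedIn ι (bar Φ).1) →ₐ[ℚ] L) : _ →+* L) ∈ (reflexCMType ι (bar Φ) φ).1 ↔
      ι.comp ((g • (reflexField ℚ L (algValuedIn ι Φ.1)).val :
        reflexField ℚ L (algValuedIn ι Φ.1) →ₐ[ℚ] L) : _ →+* L) ∉ (reflexCMType ι Φ φ).1 := by
  rw [comp_smul_val_mem_reflexCMType_iff, comp_smul_val_mem_reflexCMType_iff, algValuedIn_bar,
    reflexLift_compl, Set.mem_compl_iff]

/-- The same with the right-hand side in conjugate form: `ι ∘ g|_{K*(\bar Φ)} ∈ (\bar Φ)*_ℂ` iff the complex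
CONJUGATE of `ι ∘ g|_{K*(Φ)}` lies in `Φ*_ℂ`. [cite: Liu2021, Remark 4.4 (TeX ll. 1930–1933)] -/
theorem comp_smul_val_mem_reflexCMType_bar_iff_conjugate_mem (ι : L →+* ℂ) (Φ : CMType K)
    (φ : K →ₐ[ℚ] L) (g : L ≃ₐ[ℚ] L) :
    ι.comp ((g • (reflexField ℚ L (algValuedIn ι (bar Φ).1)).val :
        reflexField ℚ L (algValuedIn ι (bar Φ).1) →ₐ[ℚ] L) : _ →+* L) ∈ (reflexCMType ι (bar Φ) φ).1 ↔
      ComplexEmbedding.conjugate (ι.comp ((g • (reflexField ℚ L (algValuedIn ι Φ.1)).val :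
        reflexField ℚ L (algValuedIn ι Φ.1) →ₐ[ℚ] L) : _ →+* L)) ∈ (reflexCMType ι Φ φ).1 := by
  rw [comp_smul_val_mem_reflexCMType_bar_iff, conjugate_mem_iff_notMem]

/-- **"`Ψ_{μ^c}` is the opposite CM type of `Ψ_μ`"** ([Liu2021] Remark 4.4), for an arbitrary complex CM type
`Φ` in place of `Φ_μ` and `\bar Φ` in place of `Φ_{μ^c} = \bar Φ_μ`: the reflex CM type of `(K, \bar Φ)` — a CM
type of the reflex field `K*(\bar Φ) = K*(Φ)` (`reflexField_algValuedIn_bar`) — is the CONJUGATE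
`bar (reflexCMType ι Φ φ)` of the reflex CM type of `(K, Φ)`, transported along the identification
`K*(Φ) = K*(\bar Φ)` (`inducedCMType` along `IntermediateField.equivOfEq`).
[cite: Liu2021, Remark 4.4 (TeX ll. 1930–1933)] -/
theorem reflexCMType_bar (ι : L →+* ℂ) (Φ : CMType K) (φ : K →ₐ[ℚ] L) :
    reflexCMType ι (bar Φ) φ =
      inducedCMType
        ((IntermediateField.equivOfEq (reflexField_algValuedIn_bar ι Φ).symm :
            reflexField ℚ L (algValuedIn ι Φ.1) ≃ₐ[ℚ] reflexField ℚ L (algValuedIn ι (bar Φ).1)) :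
          reflexField ℚ L (algValuedIn ι Φ.1) →+* reflexField ℚ L (algValuedIn ι (bar Φ).1))
        (bar (reflexCMType ι Φ φ)) := by
  apply Subtype.ext
  ext τ
  obtain ⟨ψ, rfl⟩ := exists_algHom_comp_eq_of_normal (reflexField ℚ L (algValuedIn ι (bar Φ).1)).val ι τ
  obtain ⟨g, rfl⟩ := exists_algEquiv_smul_eq (reflexField ℚ L (algValuedIn ι (bar Φ).1)).val ψ
  rw [comp_smul_val_mem_reflexCMType_bar_iff, mem_inducedCMType_iff, mem_bar_iff, RingHom.comp_assoc,
    coe_smul_val_comp_coe_equivOfEq]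

/-- Membership form of `reflexCMType_bar` for an arbitrary complex embedding `τ` of `K*(\bar Φ)`:
`τ ∈ (\bar Φ)*_ℂ ↔ \overline{τ|_{K*(Φ)}} ∈ Φ*_ℂ`. [cite: Liu2021, Remark 4.4 (TeX ll. 1930–1933)] -/
theorem mem_reflexCMType_bar_iff (ι : L →+* ℂ) (Φ : CMType K) (φ : K →ₐ[ℚ] L)
    (τ : reflexField ℚ L (algValuedIn ι (bar Φ).1) →+* ℂ) :
    τ ∈ (reflexCMType ι (bar Φ) φ).1 ↔
      ComplexEmbedding.conjugate (τ.comp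
        ((IntermediateField.equivOfEq (reflexField_algValuedIn_bar ι Φ).symm :
            reflexField ℚ L (algValuedIn ι Φ.1) ≃ₐ[ℚ] reflexField ℚ L (algValuedIn ι (bar Φ).1)) :
          reflexField ℚ L (algValuedIn ι Φ.1) →+* reflexField ℚ L (algValuedIn ι (bar Φ).1))) ∈
        (reflexCMType ι Φ φ).1 := by
  rw [reflexCMType_bar, mem_inducedCMType_iff, mem_bar_iff, conjugate_mem_iff_notMem]

/-- The reflex CM types of `Φ` and `\bar Φ` have the same number of elements (half the degree of the common
reflex field). [cite: Shimura1998, §8.3 Prop. 28] -/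
theorem ncard_reflexCMType_bar (ι : L →+* ℂ) (Φ : CMType K) (φ : K →ₐ[ℚ] L) :
    2 * (reflexCMType ι (bar Φ) φ).1.ncard = 2 * (reflexCMType ι Φ φ).1.ncard := by
  rw [two_mul_ncard_reflexCMType, two_mul_ncard_reflexCMType]
  exact congrArg (fun M : IntermediateField ℚ L => Nat.card (M →+* ℂ)) (reflexField_algValuedIn_bar ι Φ)

end ReflexType

end Literature.NumberTheory.ComplexMultiplication
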